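import Summits.ResolutionOfSingularities.ResolutionOfSingularities.Theorems.EquisingularLiftEquisingularLiftNatExceptionalLineCone
import Mathlib.RingTheory.MvPolynomial.Ideal
import HarnessLib

/-!
# `EquisingularLiftNat(3)`, chain w45b — helper T-DIRLIFT♭ (ring level):
# blowing up a node of the special fibre of a regular surface DOUBLES the exceptional fibre and separates the branches

[OURS · L1 W4.5b] Helper object **U2 «T-DIRLIFT♭»** of the unclaimed-stub list of `res-L1-w45b-plan-1`
(2026-08-27T08:44:06Z) for the child crux item EL♮(3) = stmt-ResolutionOfSingularities-20148 (parent EL♮ =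
`Theses.EquisingularLift.EquisingularLiftNat`, stmt-…-20038; CHAIN v7.4.1 `5f83398d7e762ee8` §3 row T-DIRLIFT♭;
res-L1-w45b-lead-2 MERGE 08:12:30Z (3) + ADDENDUM 08:23:43Z: «on `C♭ = Bl_nodes(C)` the uniformizer `ϖ′` has ORDER 2
at each node of the reduced nodal `C_k`, so `C♭_k = ⋃Λ̄_i + ⋃κ_j + Σ 2·F_m` — the node fibres `F_m` are DOUBLED»).
NOT a statement of the manuscript under review (Hironaka 2017, cell `res-hironaka`); nothing here is attributed to
its author. AI-written kernel lemma, weaker than expert review. `--supports stmt-ResolutionOfSingularities-20148`.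

CHART ALGEBRA (proved for an arbitrary commutative ring, in the vocabulary of the tree's image model
`blowupAlgebra I b ⊆ R[1/b]` of the chart `Spec R[I/b]` of the blow-up along `I`, and of the companion file
`…ExceptionalLineCone.lean`, which treats the DOUBLED-PLANE cone `F - u e² ∈ I³`). Here the tangent cone is a NODE:
`F - u·e₁·e₂ ∈ I³` with `e₁, e₂ ∈ I` (two distinct tangent hyperplanes `{e₁ = 0}`, `{e₂ = 0}` of the centre's
normal space). Then:

* `exists_controlledTransform_nodeCone` — on every chart `R[I/b]`: `F = b² · F′` with
  `F′ - u (e₁/b)(e₂/b) ∈ (b)` (namely `F′ = u (e₁/b)(e₂/b) + b·(F - u e₁ e₂)/b³`); any `F′` with `F = b² F′`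
  satisfies this (`controlledTransform_node_sub_mem_span`, `b` being a non-zero-divisor of `R[I/b]`) — **the
  exceptional divisor `V(b)` enters the total transform `V(F)` with multiplicity (at least) two**;
* `controlledTransform_node_chart` — on the chart `b = e₁` (where `e₁/e₁ = 1`): `F′ - u·(e₂/e₁) ∈ (e₁)`, and
  for `u` a unit `(F′, e₁) = (e₂/e₁, e₁)` (`controlledTransform_node_sup_exceptional_eq`): **the trace of `V(F′)`
  on the exceptional divisor of this chart is the REDUCED hyperplane `{T₂ = 0}`** (contrast: the doubled line of
  the doubled-plane cone) — the branch tangent to `{e₂ = 0}` is picked up at `T₂ = 0`, the other branch at the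
  origin of the chart `b = e₂` (swap `e₁ ↔ e₂`), so the two branches are SEPARATED;
* for a QUASI-REGULAR centre `I = (x₁, …, x_r)` with `R/I` a domain, `i ≠ j`, `F - u xᵢ x_j ∈ I³`, `u ∉ I`
  (`not_dvd_controlledTransform_node`, `ker_mapQuotient_eq_span_controlledTransform_node`,
  `strictTransform_node_sup_exceptional_eq_hyperplane`): on the chart `R[I/xᵢ]` one has `xᵢ ∤ F′` (modulo `xᵢ`
  the chart ring is `(R/I)[T_l : l ≠ i]`, Stacks 0BIQ, and `F′ ↦ ū·T_j ≠ 0`), so **`F = xᵢ² F′` with `xᵢ` PRIME and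
  `xᵢ ∤ F′`: the exceptional divisor has multiplicity EXACTLY two in `V(F)`** (`algebraMap_notMem_span_pow_three`:
  `F ∉ (xᵢ)³`), `(F′)` IS the kernel of the chart map `R[I/xᵢ] → (R/(F))[Ī/x̄ᵢ]` (so `V(F′)` is the STRICT transform
  of `V(F)`), and `ker + (xᵢ) = (x_j/xᵢ, xᵢ)`;
* `nodeBlowup_doubledFibre_rsop` — the same at the closed point of a regular local ring with a regular system of
  parameters `x₁, …, x_d` (`(x) = 𝔪`; a regular system of parameters is quasi-regular, Matsumura Thm. 16.2 (i));
* `span_frac_algebraMap_isMaximal_of_two` — for `d = 2` the ideal `(x_j/xᵢ, xᵢ)` is MAXIMAL (residue field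
  `k = R/𝔪`): the strict transform of the branch crosses the node fibre at ONE CLOSED POINT of the chart.

GEOMETRIC READING (lead-2's T-DIRLIFT♭ setting, by hand there, kernel-checked here on the charts): `d = 2`,
`R = 𝒪_{C,m}` the local ring of a regular surface `C`, flat over a DVR `O′` with uniformizer `ϖ′`, at a closed point
`m` which is a NODE of the special fibre `C_k = V(ϖ′)` with the two tangent lines `{x₁ = 0}`, `{x₂ = 0}`:
`ϖ′ - u x₁ x₂ ∈ 𝔪³`, `u ∈ R^×`. On the chart `x₁` of `C♭ = Bl_m C` the special fibre `V(ϖ′)` is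
`ϖ′ = x₁² · ϖ″` with `x₁` prime (the node fibre `F_m ∩ chart = V(x₁) ≅ 𝔸¹_k`) and `x₁ ∤ ϖ″`, `V(ϖ″)` = the strict
transform of `C_k` (the branch `Λ̄` tangent to `{x₂ = 0}`), meeting `F_m` in the single reduced point `T₂ = 0`:
**`C♭_k = Λ̄ + 2·F_m` near that point** — the node fibre is DOUBLED, E1/admissibility bookkeeping as in the ADDENDUM.
All statements [folklore]-level commutative algebra; axioms standard.

References: res-L1-w45b-lead-2 LEAD-MEMO-4 `04d94900ec40ad51` §2 + MERGE/ADDENDUM lines (OURS); U. Görtz, T. Wedhorn,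
*Algebraic Geometry I* (2nd ed. 2020), (13.19) and Prop. 13.96 (2), p. 415–416; The Stacks Project, Tag 0BIQ;
H. Matsumura, *Commutative Ring Theory*, Thm. 16.2 (i); Q. Liu, *Algebraic Geometry and Arithmetic Curves*,
§8.1 and §9.2 (blowing up a closed point of a regular fibred surface) — context only.
-/

set_option linter.dupNamespace false -- mandated namespace `Summit.<Summit>.<Problem>` of this single-conjunct summit

noncomputable section

namespace Summit.ResolutionOfSingularities.ResolutionOfSingularities.Cruxes.EquisingularLiftNat.Sections

open IsLocalization Literature.AlgebraicGeometry.Resolution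

universe u

variable {R : Type u} [CommRing R]

/-! ## The controlled transform `F′ = F/b²` of a node cone on the chart `R[I/b]` -/

/-- **The controlled transform of a node cone.** If `e₁, e₂ ∈ I` and `F - u·e₁·e₂ ∈ I³`, then on the chart
`R[I/b]` of the blow-up along `I` one has `F = b²·F′` with `F′ - u·(e₁/b)·(e₂/b) ∈ (b)`
(namely `F′ = u (e₁/b)(e₂/b) + b·((F - u e₁ e₂)/b³)`). [folklore] -/
theorem exists_controlledTransform_nodeCone (I : Ideal R) (b : R) {e₁ e₂ u F : R} (he₁ : e₁ ∈ I)
    (he₂ : e₂ ∈ I) (hF : F - u * e₁ * e₂ ∈ I ^ 3) :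
    ∃ F' : blowupAlgebra I b,
      algebraMap R (blowupAlgebra I b) F = algebraMap R (blowupAlgebra I b) b ^ 2 * F' ∧
      F' - algebraMap R (blowupAlgebra I b) u * blowupAlgebra.gen I b e₁ he₁ * blowupAlgebra.gen I b e₂ he₂ ∈
        Ideal.span {algebraMap R (blowupAlgebra I b) b} := by
  -- `g := (F - u e₁ e₂)/b³ ∈ R[I/b]`
  let g : blowupAlgebra I b :=
    ⟨algebraMap R (Localization.Away b) (F - u * e₁ * e₂) * Away.invSelf b ^ 3,
      algebraMap_mul_invSelf_pow_mem_blowupAlgebra (I := I) (a := b) 3 hF⟩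
  refine ⟨algebraMap R (blowupAlgebra I b) u * blowupAlgebra.gen I b e₁ he₁ * blowupAlgebra.gen I b e₂ he₂ +
      algebraMap R (blowupAlgebra I b) b * g, ?_, ?_⟩
  · -- check `F = b² (u (e₁/b)(e₂/b) + b g)` in `R[1/b]`
    apply Subtype.ext
    change algebraMap R (Localization.Away b) F =
      algebraMap R (Localization.Away b) b ^ 2 *
        (algebraMap R (Localization.Away b) u *
            (algebraMap R (Localization.Away b) e₁ * Away.invSelf b) *
            (algebraMap R (Localization.Away b) e₂ * Away.invSelf b) +
          algebraMap R (Localization.Away b) b *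
            (algebraMap R (Localization.Away b) (F - u * e₁ * e₂) * Away.invSelf b ^ 3))
    have hb : algebraMap R (Localization.Away b) b * Away.invSelf b = 1 := Away.mul_invSelf b
    have key : algebraMap R (Localization.Away b) b ^ 2 *
        (algebraMap R (Localization.Away b) u *
            (algebraMap R (Localization.Away b) e₁ * Away.invSelf b) *
            (algebraMap R (Localization.Away b) e₂ * Away.invSelf b) +
          algebraMap R (Localization.Away b) b *
            (algebraMap R (Localization.Away b) (F - u * e₁ * e₂) * Away.invSelf b ^ 3)) =
        (algebraMap R (Localization.Away b) b * Away.invSelf b) ^ 2 *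
            (algebraMap R (Localization.Away b) u * algebraMap R (Localization.Away b) e₁ *
              algebraMap R (Localization.Away b) e₂) +
          (algebraMap R (Localization.Away b) b * Away.invSelf b) ^ 3 *
            algebraMap R (Localization.Away b) (F - u * e₁ * e₂) := by
      ring
    rw [key, hb, one_pow, one_pow, one_mul, one_mul, map_sub, map_mul, map_mul]
    ring
  · rw [add_sub_cancel_left]
    exact Ideal.mul_mem_right _ _ (Ideal.mem_span_singleton_self _)

/-- Every `F′` with `F = b² F′` on `R[I/b]` satisfies `F′ - u (e₁/b)(e₂/b) ∈ (b)` (node cone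
`F - u e₁ e₂ ∈ I³`; `b` is a non-zero-divisor of `R[I/b]`, `controlledTransform_unique`). [folklore] -/
theorem controlledTransform_node_sub_mem_span (I : Ideal R) (b : R) {e₁ e₂ u F : R} (he₁ : e₁ ∈ I)
    (he₂ : e₂ ∈ I) (hF : F - u * e₁ * e₂ ∈ I ^ 3) {F' : blowupAlgebra I b}
    (hF' : algebraMap R (blowupAlgebra I b) F = algebraMap R (blowupAlgebra I b) b ^ 2 * F') :
    F' - algebraMap R (blowupAlgebra I b) u * blowupAlgebra.gen I b e₁ he₁ * blowupAlgebra.gen I b e₂ he₂ ∈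
      Ideal.span {algebraMap R (blowupAlgebra I b) b} := by
  obtain ⟨F'', hF'', hmem⟩ := exists_controlledTransform_nodeCone I b he₁ he₂ hF
  rwa [controlledTransform_unique I b hF' hF'']

/-- **The chart `b = e₁`: the branch tangent to `{e₂ = 0}`.** There `e₁/e₁ = 1`, so every `F′` with `F = e₁² F′`
satisfies `F′ - u·(e₂/e₁) ∈ (e₁)`: modulo the exceptional equation the controlled transform is `u` times the
affine coordinate `T₂ = e₂/e₁` of the exceptional divisor. [folklore] -/
theorem controlledTransform_node_chart (I : Ideal R) {e₁ e₂ u F : R} (he₁ : e₁ ∈ I) (he₂ : e₂ ∈ I)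
    (hF : F - u * e₁ * e₂ ∈ I ^ 3) {F' : blowupAlgebra I e₁}
    (hF' : algebraMap R (blowupAlgebra I e₁) F = algebraMap R (blowupAlgebra I e₁) e₁ ^ 2 * F') :
    F' - algebraMap R (blowupAlgebra I e₁) u * blowupAlgebra.gen I e₁ e₂ he₂ ∈
      Ideal.span {algebraMap R (blowupAlgebra I e₁) e₁} := by
  have h := controlledTransform_node_sub_mem_span I e₁ he₁ he₂ hF hF'
  rwa [blowupAlgebra.gen_self I e₁ he₁, mul_one] at h

/-- **`V(F′) ∩ E = {T₂ = 0}` on the chart `b = e₁`** (reduced!): if the cone coefficient `u` is a unit, the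
ideals `(F′, e₁)` and `(e₂/e₁, e₁)` of `R[I/e₁]` coincide. [folklore] -/
theorem controlledTransform_node_sup_exceptional_eq (I : Ideal R) {e₁ e₂ u F : R} (he₁ : e₁ ∈ I)
    (he₂ : e₂ ∈ I) (hu : IsUnit u) (hF : F - u * e₁ * e₂ ∈ I ^ 3) {F' : blowupAlgebra I e₁}
    (hF' : algebraMap R (blowupAlgebra I e₁) F = algebraMap R (blowupAlgebra I e₁) e₁ ^ 2 * F') :
    Ideal.span {F', algebraMap R (blowupAlgebra I e₁) e₁} =
      Ideal.span {blowupAlgebra.gen I e₁ e₂ he₂, algebraMap R (blowupAlgebra I e₁) e₁} := by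
  have h := controlledTransform_node_chart I he₁ he₂ hF hF'
  obtain ⟨c, hc⟩ := Ideal.mem_span_singleton'.mp h
  -- `F' = u (e₂/e₁) + c e₁`
  have hF'eq : F' = algebraMap R (blowupAlgebra I e₁) u * blowupAlgebra.gen I e₁ e₂ he₂ +
      c * algebraMap R (blowupAlgebra I e₁) e₁ := by
    rw [hc]; ring
  obtain ⟨v, hv⟩ := hu
  have huv : algebraMap R (blowupAlgebra I e₁) (↑v⁻¹ : R) * algebraMap R (blowupAlgebra I e₁) u = 1 := by
    rw [← map_mul, ← hv, Units.inv_mul, map_one]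
  apply le_antisymm
  · rw [Ideal.span_le, Set.insert_subset_iff, Set.singleton_subset_iff, SetLike.mem_coe,
      SetLike.mem_coe, Ideal.mem_span_pair, Ideal.mem_span_pair]
    exact ⟨⟨algebraMap R (blowupAlgebra I e₁) u, c, by rw [hF'eq]⟩, ⟨0, 1, by ring⟩⟩
  · rw [Ideal.span_le, Set.insert_subset_iff, Set.singleton_subset_iff, SetLike.mem_coe,
      SetLike.mem_coe, Ideal.mem_span_pair, Ideal.mem_span_pair]
    refine ⟨⟨algebraMap R (blowupAlgebra I e₁) (↑v⁻¹ : R),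
      -(algebraMap R (blowupAlgebra I e₁) (↑v⁻¹ : R) * c), ?_⟩, ⟨0, 1, by ring⟩⟩
    -- `e₂/e₁ = v⁻¹ F' - v⁻¹ c e₁`
    rw [hF'eq, mul_add, ← mul_assoc, huv, one_mul]
    ring

/-! ## Quasi-regular centres: `F′` is the strict transform, the exceptional divisor is exactly doubled -/

section QuasiRegular

variable {r : ℕ} (x : Fin r → R) (i j : Fin r)

/-- **`xᵢ ∤ F′`** for a quasi-regular centre `I = (x₁, …, x_r)` with `R/I` a domain, chart `b = xᵢ`, second
tangent hyperplane `x_j` (`j ≠ i`) and cone coefficient `u ∉ I`: modulo `(xᵢ)` the chart ring is the polynomial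
ring `(R/I)[T_l : l ≠ i]` (Stacks 0BIQ) and `F′ ↦ ū·T_j ≠ 0`. [cite: StacksProject, Tag 0BIQ] -/
theorem not_dvd_controlledTransform_node (hx : IsQuasiRegular x) (hji : j ≠ i) {u F : R}
    (hu : u ∉ Ideal.span (Set.range x))
    (hF : F - u * x i * x j ∈ Ideal.span (Set.range x) ^ 3)
    {F' : blowupAlgebra (Ideal.span (Set.range x)) (x i)}
    (hF' : algebraMap R _ F = algebraMap R _ (x i) ^ 2 * F') :
    ¬ algebraMap R (blowupAlgebra (Ideal.span (Set.range x)) (x i)) (x i) ∣ F' := by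
  intro hdvd
  have h := controlledTransform_node_chart (Ideal.span (Set.range x)) (blowupAlgebra.mem_span_range x i)
    (blowupAlgebra.mem_span_range x j) hF hF'
  have hmem : algebraMap R _ u * blowupAlgebra.frac x i j ∈
      Ideal.span {algebraMap R (blowupAlgebra (Ideal.span (Set.range x)) (x i)) (x i)} := by
    have h2 : F' ∈ Ideal.span {algebraMap R (blowupAlgebra (Ideal.span (Set.range x)) (x i)) (x i)} :=
      Ideal.mem_span_singleton.mpr hdvd
    have := Ideal.sub_mem _ h2 h
    rwa [sub_sub_cancel] at this
  -- `u (x_j/x_i) = eval (C u * T_j)`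
  have heval : blowupAlgebra.eval x i (MvPolynomial.C u * MvPolynomial.X ⟨j, hji⟩) =
      algebraMap R _ u * blowupAlgebra.frac x i j := by
    rw [map_mul, blowupAlgebra.eval_C, blowupAlgebra.eval_X]
  rw [← heval, blowupAlgebra.eval_mem_span_algebraMap_iff x i hx] at hmem
  have hc := hmem (Finsupp.single ⟨j, hji⟩ 1)
  rw [MvPolynomial.coeff_C_mul, MvPolynomial.coeff_X, if_pos rfl, mul_one] at hc
  exact hu hc


/-- `xᵢ` has multiplicity EXACTLY two in the total transform: `xᵢ³ ∤ F` in `R[I/xᵢ]` (quasi-regular centre,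
`R/I` a domain, `j ≠ i`, `u ∉ I`, `F - u xᵢ x_j ∈ I³`) — since `F = xᵢ² F′`, `xᵢ` is a non-zero-divisor of the
chart ring and `xᵢ ∤ F′`. This is lead-2's «the uniformizer has ORDER 2 at the node: the node fibre is DOUBLED,
not tripled». [cite: StacksProject, Tag 0BIQ] -/
theorem not_pow_three_dvd_algebraMap_node (hx : IsQuasiRegular x) (hji : j ≠ i) {u F : R}
    (hu : u ∉ Ideal.span (Set.range x))
    (hF : F - u * x i * x j ∈ Ideal.span (Set.range x) ^ 3) :
    ¬ algebraMap R (blowupAlgebra (Ideal.span (Set.range x)) (x i)) (x i) ^ 3 ∣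
      algebraMap R (blowupAlgebra (Ideal.span (Set.range x)) (x i)) F := by
  obtain ⟨F', hF', -⟩ := exists_controlledTransform_nodeCone (Ideal.span (Set.range x)) (x i)
    (blowupAlgebra.mem_span_range x i) (blowupAlgebra.mem_span_range x j) hF
  rintro ⟨c, hc⟩
  apply not_dvd_controlledTransform_node x i j hx hji hu hF hF'
  refine ⟨c, ?_⟩
  have hreg := pow_mem (algebraMap_mem_nonZeroDivisors_blowupAlgebra (I := Ideal.span (Set.range x))
    (a := x i)) 2
  apply (mul_cancel_left_mem_nonZeroDivisors hreg).mp
  rw [← hF', hc]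
  ring

/-- **`V(F′)` is the strict transform**: for `x` quasi-regular, `R/I` a domain, `j ≠ i`, `u ∉ I` and
`F - u xᵢ x_j ∈ I³`, the kernel of the chart map `R[I/xᵢ] → (R/(F))[Ī/x̄ᵢ]` onto the chart ring of the blow-up
of the hypersurface `R/(F)` along `Ī` is `(F′)`. [cite: GortzWedhorn2020, Prop. 13.96 (2) and p. 416] -/
theorem ker_mapQuotient_eq_span_controlledTransform_node (hx : IsQuasiRegular x)
    [IsDomain (R ⧸ Ideal.span (Set.range x))] (hji : j ≠ i) {u F : R}
    (hu : u ∉ Ideal.span (Set.range x))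
    (hF : F - u * x i * x j ∈ Ideal.span (Set.range x) ^ 3)
    {F' : blowupAlgebra (Ideal.span (Set.range x)) (x i)}
    (hF' : algebraMap R _ F = algebraMap R _ (x i) ^ 2 * F') :
    RingHom.ker (blowupAlgebra.mapQuotient (Ideal.span (Set.range x)) (x i) (Ideal.span {F})) =
      Ideal.span {F'} :=
  blowupAlgebra.ker_mapQuotient_eq_span (Ideal.span (Set.range x)) (x i) hF'
    (prime_algebraMap_of_isQuasiRegular x i hx) (not_dvd_controlledTransform_node x i j hx hji hu hF hF')

/-- **T-DIRLIFT♭ on the chart, quasi-regular form.** Let `I = (x₁, …, x_r) ⊆ R` be generated by a quasi-regular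
sequence with `R/I` a domain, `i ≠ j`, and let `F ∈ R` have a NODE cone with tangent hyperplanes `{xᵢ = 0}`,
`{x_j = 0}`: `F - u·xᵢ·x_j ∈ I³`, `u` a unit. Then on the chart `Spec R[I/xᵢ]` of the blow-up of `Spec R` along
`V(I)`: the strict transform of `V(F)` (cut out by the kernel of `R[I/xᵢ] → (R/(F))[Ī/x̄ᵢ]`) meets the exceptional
divisor `V(xᵢ)` in the REDUCED hyperplane `{x_j/xᵢ = 0}`: `ker + (xᵢ) = (x_j/xᵢ, xᵢ)` — one reduced point when
`r = 2`. [OURS · L1 W4.5b] [cite: GortzWedhorn2020, Prop. 13.96 (2) and p. 416] -/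
theorem strictTransform_node_sup_exceptional_eq_hyperplane (hx : IsQuasiRegular x)
    [IsDomain (R ⧸ Ideal.span (Set.range x))] (hji : j ≠ i) {u F : R} (hunit : IsUnit u)
    (hu : u ∉ Ideal.span (Set.range x))
    (hF : F - u * x i * x j ∈ Ideal.span (Set.range x) ^ 3) :
    RingHom.ker (blowupAlgebra.mapQuotient (Ideal.span (Set.range x)) (x i) (Ideal.span {F})) ⊔
        Ideal.span {algebraMap R (blowupAlgebra (Ideal.span (Set.range x)) (x i)) (x i)} =
      Ideal.span {blowupAlgebra.frac x i j,
        algebraMap R (blowupAlgebra (Ideal.span (Set.range x)) (x i)) (x i)} := by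
  obtain ⟨F', hF', -⟩ := exists_controlledTransform_nodeCone (Ideal.span (Set.range x)) (x i)
    (blowupAlgebra.mem_span_range x i) (blowupAlgebra.mem_span_range x j) hF
  rw [ker_mapQuotient_eq_span_controlledTransform_node x i j hx hji hu hF hF', ← Ideal.span_union,
    Set.singleton_union]
  exact controlledTransform_node_sup_exceptional_eq (Ideal.span (Set.range x))
    (blowupAlgebra.mem_span_range x i) (blowupAlgebra.mem_span_range x j) hunit hF hF'

end QuasiRegular

/-! ## At a closed point of a regular scheme: the centre is the maximal ideal -/

/-- **T-DIRLIFT♭ at a regular point (node of a hypersurface; `d = 2`: node of the special fibre of a regular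
surface over a DVR).** Let `(R, 𝔪)` be a regular local ring with regular system of parameters `x₁, …, x_d`
(`(x) = 𝔪`, `d = emb dim R`), `i ≠ j`, and `F ∈ R` with `F - u·xᵢ·x_j ∈ 𝔪³`, `u` a unit — the tangent cone of
`V(F)` at the closed point is the pair of distinct hyperplanes `{xᵢ = 0} ∪ {x_j = 0}` (for `d = 2` and `F = ϖ′` the
uniformizer of a DVR `O′ → R`: the closed point is a NODE of the special fibre `V(ϖ′)`). Then on the chart
`B = R[𝔪/xᵢ]` of the blow-up of the closed point:
(1) `F = xᵢ²·F′` for some `F′ ∈ B` NOT divisible by the prime element `xᵢ` of `B` — the exceptional divisor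
`E ∩ chart = V(xᵢ)` (for `d = 2`: the node fibre `F_m ≅ ℙ¹`, here its affine line) appears in the total transform
`V(F)` with multiplicity EXACTLY two («the node fibres are DOUBLED: `C♭_k = ⋃Λ̄ + Σ 2·F_m`»), and `xᵢ³ ∤ F`;
(2) `(F′)` is the kernel of `B → (R/(F))[𝔪̄/x̄ᵢ]`, i.e. `V(F′)` is the strict transform of `V(F)` (for `d = 2`: of the
special fibre `C_k`, i.e. the branches `Λ̄`);
(3) `ker + (xᵢ) = (x_j/xᵢ, xᵢ)`: the strict transform meets `E` on this chart exactly in the reduced hyperplane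
`{T_j = 0}` of `E ∩ chart ≅ 𝔸^{d-1}_k` — for `d = 2` the single reduced point `T_j = 0` (the branch tangent to
`{x_j = 0}`; the other branch is picked up on the chart `x_j`), so the two branches of the node are SEPARATED and
each crosses the node fibre transversally.
A regular system of parameters is quasi-regular (Matsumura Thm. 16.2 (i)) and `R/𝔪` is a field, so the
quasi-regular statements apply. [OURS · L1 W4.5b] [cite: Matsumura1987, Thm. 16.2 (i)] -/
theorem nodeBlowup_doubledFibre_rsop [IsRegularLocalRing R] {d : ℕ}
    (hd : (IsLocalRing.maximalIdeal R).spanFinrank = d) (x : Fin d → R)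
    (hx𝔪 : Ideal.span (Set.range x) = IsLocalRing.maximalIdeal R) (i j : Fin d) (hji : j ≠ i)
    {u F : R} (hu : IsUnit u) (hF : F - u * x i * x j ∈ IsLocalRing.maximalIdeal R ^ 3) :
    (∃ F' : blowupAlgebra (Ideal.span (Set.range x)) (x i),
        algebraMap R _ F = algebraMap R _ (x i) ^ 2 * F' ∧
        Prime (algebraMap R (blowupAlgebra (Ideal.span (Set.range x)) (x i)) (x i)) ∧
        ¬ algebraMap R (blowupAlgebra (Ideal.span (Set.range x)) (x i)) (x i) ∣ F' ∧
        RingHom.ker (blowupAlgebra.mapQuotient (Ideal.span (Set.range x)) (x i) (Ideal.span {F})) =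
          Ideal.span {F'}) ∧
      ¬ algebraMap R (blowupAlgebra (Ideal.span (Set.range x)) (x i)) (x i) ^ 3 ∣
          algebraMap R (blowupAlgebra (Ideal.span (Set.range x)) (x i)) F ∧
      RingHom.ker (blowupAlgebra.mapQuotient (Ideal.span (Set.range x)) (x i) (Ideal.span {F})) ⊔
          Ideal.span {algebraMap R (blowupAlgebra (Ideal.span (Set.range x)) (x i)) (x i)} =
        Ideal.span {blowupAlgebra.frac x i j,
          algebraMap R (blowupAlgebra (Ideal.span (Set.range x)) (x i)) (x i)} := by
  have hx : IsQuasiRegular x := isQuasiRegular_rsop_comp hd x hx𝔪 id Function.injective_id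
  haveI : IsDomain (R ⧸ Ideal.span (Set.range x)) := by
    rw [Ideal.Quotient.isDomain_iff_prime, hx𝔪]
    exact (IsLocalRing.maximalIdeal.isMaximal R).isPrime
  have hu' : u ∉ Ideal.span (Set.range x) := by
    rw [hx𝔪]
    exact fun h => (IsLocalRing.mem_maximalIdeal u).mp h hu
  have hF' : F - u * x i * x j ∈ Ideal.span (Set.range x) ^ 3 := by rwa [hx𝔪]
  obtain ⟨F', hFF', -⟩ := exists_controlledTransform_nodeCone (Ideal.span (Set.range x)) (x i)
    (blowupAlgebra.mem_span_range x i) (blowupAlgebra.mem_span_range x j) hF'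
  exact ⟨⟨F', hFF', prime_algebraMap_of_isQuasiRegular x i hx,
      not_dvd_controlledTransform_node x i j hx hji hu' hF' hFF',
      ker_mapQuotient_eq_span_controlledTransform_node x i j hx hji hu' hF' hFF'⟩,
    not_pow_three_dvd_algebraMap_node x i j hx hji hu' hF',
    strictTransform_node_sup_exceptional_eq_hyperplane x i j hx hji hu hu' hF'⟩

/-! ## `d = 2`: the branch crosses the node fibre at a closed point -/

/-- In `Fin 2` the index different from `i` is unique (cf. `fin_two_eq_of_ne_of_ne` of
`…EquimultipleAlongTraceRegular.lean`, not imported here). [folklore] -/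
private theorem fin_two_index_eq {i j l : Fin 2} (hji : j ≠ i) (hli : l ≠ i) : l = j := by
  fin_cases i <;> fin_cases j <;> fin_cases l <;> simp_all

/-- A polynomial minus its constant term lies in the ideal of the variables. [folklore] -/
theorem mvPolynomial_sub_C_coeff_zero_mem_span_X {σ : Type*} (p : MvPolynomial σ R) :
    p - MvPolynomial.C (p.coeff 0) ∈ Ideal.span (Set.range (MvPolynomial.X : σ → MvPolynomial σ R)) := by
  rw [← Set.image_univ, MvPolynomial.mem_ideal_span_X_image]
  intro m hm
  have hm0 : m ≠ 0 := by
    rintro rfl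
    rw [MvPolynomial.mem_support_iff, MvPolynomial.coeff_sub, MvPolynomial.coeff_zero_C, sub_self] at hm
    exact hm rfl
  obtain ⟨l, hl⟩ := Finsupp.ne_iff.mp hm0
  exact ⟨l, Set.mem_univ _, by simpa using hl⟩

/-- **`d = 2`: the branch crosses the node fibre at a CLOSED point.** For a regular local ring `(R, 𝔪)` of
embedding dimension `2` with regular system of parameters `x₁, x₂` and `i ≠ j`, the ideal `(x_j/xᵢ, xᵢ)` of the
chart ring `B = R[𝔪/xᵢ]` — the point `T_j = 0` of the exceptional line `E ∩ chart = V(xᵢ) ≅ 𝔸¹_k` — is a MAXIMAL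
ideal (residue field `k = R/𝔪`: modulo it every element of `B = R[x_j/xᵢ]` is congruent to a constant).
[OURS · L1 W4.5b] [cite: StacksProject, Tag 0BIQ] -/
theorem span_frac_algebraMap_isMaximal_of_two [IsRegularLocalRing R]
    (hd : (IsLocalRing.maximalIdeal R).spanFinrank = 2) (x : Fin 2 → R)
    (hx𝔪 : Ideal.span (Set.range x) = IsLocalRing.maximalIdeal R) (i j : Fin 2) (hji : j ≠ i) :
    (Ideal.span {blowupAlgebra.frac x i j,
      algebraMap R (blowupAlgebra (Ideal.span (Set.range x)) (x i)) (x i)}).IsMaximal := by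
  set B := blowupAlgebra (Ideal.span (Set.range x)) (x i) with hB
  have hx : IsQuasiRegular x := isQuasiRegular_rsop_comp hd x hx𝔪 id Function.injective_id
  have hσ : ∀ l : {l : Fin 2 // l ≠ i}, l = ⟨j, hji⟩ := fun l =>
    Subtype.ext (fin_two_index_eq hji l.2)
  -- the variables of `R[T_l : l ≠ i]` all go to `x_j/xᵢ`
  have hXle : (Ideal.span (Set.range (MvPolynomial.X : {l : Fin 2 // l ≠ i} →
      MvPolynomial {l : Fin 2 // l ≠ i} R))).map (blowupAlgebra.eval x i).toRingHom ≤
      Ideal.span {blowupAlgebra.frac x i j, algebraMap R B (x i)} := by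
    rw [Ideal.map_span, Ideal.span_le]
    rintro _ ⟨_, ⟨l, rfl⟩, rfl⟩
    rw [hσ l]
    change blowupAlgebra.eval x i (MvPolynomial.X ⟨j, hji⟩) ∈ _
    rw [blowupAlgebra.eval_X]
    exact Ideal.subset_span (Set.mem_insert _ _)
  -- `𝔪 B = (xᵢ) ⊆ J`
  have h𝔪le : (IsLocalRing.maximalIdeal R).map (algebraMap R B) ≤
      Ideal.span {blowupAlgebra.frac x i j, algebraMap R B (x i)} := by
    rw [← hx𝔪, map_blowupAlgebra_eq_span (blowupAlgebra.mem_span_range x i), Ideal.span_singleton_le_iff_mem]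
    exact Ideal.subset_span (Set.mem_insert_of_mem _ (Set.mem_singleton _))
  -- every `z ∈ B` is a constant modulo `J`
  have hconst : ∀ z : B, ∃ c : R, z - algebraMap R B c ∈
      Ideal.span {blowupAlgebra.frac x i j, algebraMap R B (x i)} := by
    intro z
    obtain ⟨p, rfl⟩ := blowupAlgebra.eval_surjective x i z
    refine ⟨p.coeff 0, hXle ?_⟩
    have h := Ideal.mem_map_of_mem (blowupAlgebra.eval x i).toRingHom (mvPolynomial_sub_C_coeff_zero_mem_span_X p)
    rwa [map_sub, AlgHom.toRingHom_eq_coe, RingHom.coe_coe, blowupAlgebra.eval_C] at h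
  rw [Ideal.isMaximal_iff]
  constructor
  · -- `1 ∉ J`: modulo `(xᵢ)`, `1 = a·(x_j/xᵢ)` would put the constant coefficient `1` in `𝔪`
    intro h1
    obtain ⟨a, b, hab⟩ := Ideal.mem_span_pair.mp h1
    obtain ⟨p, rfl⟩ := blowupAlgebra.eval_surjective x i a
    have hmem : blowupAlgebra.eval x i (1 - p * MvPolynomial.X ⟨j, hji⟩) ∈
        Ideal.span {algebraMap R B (x i)} := by
      have : blowupAlgebra.eval x i (1 - p * MvPolynomial.X ⟨j, hji⟩) = b * algebraMap R B (x i) := by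
        rw [map_sub, map_one, map_mul, blowupAlgebra.eval_X, ← hab]; ring
      rw [this]
      exact Ideal.mul_mem_left _ _ (Ideal.mem_span_singleton_self _)
    rw [blowupAlgebra.eval_mem_span_algebraMap_iff x i hx] at hmem
    have h0 := hmem 0
    rw [MvPolynomial.coeff_sub, MvPolynomial.coeff_one, if_pos rfl, MvPolynomial.coeff_mul_X', Finsupp.support_zero,
      if_neg (Finset.notMem_empty _), sub_zero, hx𝔪] at h0
    exact (IsLocalRing.maximalIdeal.isMaximal R).ne_top ((Ideal.eq_top_iff_one _).mpr h0)
  · intro K z hJK hzJ hzK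
    obtain ⟨c, hc⟩ := hconst z
    have hc𝔪 : c ∉ IsLocalRing.maximalIdeal R := by
      intro hc'
      apply hzJ
      have h := Ideal.add_mem _ hc (h𝔪le (Ideal.mem_map_of_mem (algebraMap R B) hc'))
      rwa [sub_add_cancel] at h
    have hu : IsUnit (algebraMap R B c) := by
      have : IsUnit c := by by_contra h; exact hc𝔪 ((IsLocalRing.mem_maximalIdeal _).mpr h)
      exact this.map _
    have hcK : algebraMap R B c ∈ K := by
      have h := K.sub_mem hzK (hJK hc)
      rwa [sub_sub_cancel] at h
    exact K.eq_top_iff_one.mp (K.eq_top_of_isUnit_mem hcK hu)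

end Summit.ResolutionOfSingularities.ResolutionOfSingularities.Cruxes.EquisingularLiftNat.Sections

end
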